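import Mathlib.Computability.TuringMachine.Computable
import Mathlib.Data.Fintype.Option
import Mathlib.Data.Fintype.Prod
import Mathlib.Algebra.Polynomial.Eval.Defs
import Literature.Computability.Complexity.TimeBounds
import Literature.Computability.Complexity.TimeBoundsProofs
import HarnessLib

/-!
# Complexity core: finite-state transducers are linear-time computable

Trunk `CplxCore`, part of the `FinTM2` toolkit (with `TimeBoundsProofs.lean`: composition;
`TM2Simulation.lean`: statement lifting and the flag wrapper). A
deterministic finite-state transducer (`FST σ Γ₀ Γ₁`; a Mealy machine / generalised sequential
machine with a final flush) reads its input once, emitting a word per symbol; at the end of the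
input it prepends a word `front s` depending on the final state `s`, and it may discard the
emitted body (`keep s = false`). Its transduction is `FST.eval`.

Main results:

* `TM2Lift.fstTM T` — a three-stack `Turing.FinTM2` (input, auxiliary, output) computing
  `T.eval`: read phase (pop input, push the emitted words on the auxiliary stack), move phase
  (auxiliary stack onto the output stack, restoring the order; or discarding), finish (push
  `front`, reset, halt); `TM2Lift.fst_run` is the exact step count `n + |body| + 3`;
* `FST.timeComputable_eval` — `T.eval` is `TimeComputable id id` in time
  `(maxEmit + 1) · n + 3`; `FST.polyTimeComputable_eval` — hence polynomial-time.

These are the work-horses for the re-encodings between alphabets in the `NP` model bridge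
(`LengthCheck.lean`, `NPBridge.lean`). Compare `NondeterministicProofs.lean` (`PairFstTM`),
where one specific transduction (`z ↦ (boolUnpair z).1`) is compiled into a machine by hand;
the present file does this once for all finite-state transductions.

## Design notes

* `σ`, `Γ₀`, `Γ₁` finite (the machine's state is `(σ × Option Γ₀) × Option Γ₁`). No
  inhabitedness of `Γ₁` is assumed: pushes of state-dependent symbols are realised by finite
  case distinctions over `σ × Γ₀`, `Γ₁`, `σ` (`fstEmit`, `fstOut`, `fstFront`), hence the
  construction is `noncomputable` (it enumerates `Finset.univ`).
* Stack index type `TM2Lift.Stk3`, alphabet family `TM2Lift.fstΓ` (reducible pattern match),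
  labels `TM2Lift.FSTLabel`; stack contents via `TM2Lift.fstStk i a o`.
* Runs are exact iterates `(flip bind step)^[n] (some c) = some d`, chained by two private
  one-line repackagings of `TM2Comp.iterate_bind_succ` / `Function.iterate_add_apply` (as in
  `OracleProofs.lean`); the multi-push statement `pushAll` is likewise a private helper, so
  that this file depends only on `TimeBoundsProofs.lean`.

## References

* J. E. Hopcroft, J. D. Ullman, *Introduction to Automata Theory, Languages, and Computation*,
  Addison-Wesley 1979, §2.7 (Moore and Mealy machines), §11.2 (generalised sequential
  machines). (Not held; the notion is standard — the results here are folklore.)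
* S. Arora, B. Barak, *Computational Complexity: A Modern Approach*, CUP 2009, §1.2.
-/

namespace Literature.Computability.Complexity

open Turing StateTransition

/-! ### finite-state transducers -/

/-- A deterministic finite-state transducer with states `σ`, input alphabet `Γ₀`, output
alphabet `Γ₁`: an initial state, a step function emitting a word per input symbol, a final
`front` word prepended at the end, and a final `keep` decision (if `false` the emitted body is
discarded). [Hopcroft–Ullman 1979, §2.7 (Mealy machines / gsm)] [folklore] -/
structure FST (σ Γ₀ Γ₁ : Type) where
  /-- initial state -/
  init : σ
  /-- transition: new state and emitted word -/
  step : σ → Γ₀ → σ × List Γ₁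
  /-- word prepended to the output, as a function of the final state -/
  front : σ → List Γ₁
  /-- whether the emitted body is kept, as a function of the final state -/
  keep : σ → Bool

namespace FST

variable {σ Γ₀ Γ₁ : Type} (T : FST σ Γ₀ Γ₁)

/-- Run the transducer from state `s` on the word `l`: final state and emitted body. [folklore] -/
def run : σ → List Γ₀ → σ × List Γ₁
  | s, [] => (s, [])
  | s, a :: l => ((run (T.step s a).1 l).1, (T.step s a).2 ++ (run (T.step s a).1 l).2)

/-- Running on the empty word. [folklore] -/
@[simp] theorem run_nil (s : σ) : T.run s [] = (s, []) := rfl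
/-- Running on `a :: l`: one transition, then the rest. [folklore] -/
@[simp] theorem run_cons (s : σ) (a : Γ₀) (l : List Γ₀) :
    T.run s (a :: l) = ((T.run (T.step s a).1 l).1, (T.step s a).2 ++ (T.run (T.step s a).1 l).2) :=
  rfl

/-- Running on a concatenation. [folklore] -/
theorem run_append (s : σ) (l₁ l₂ : List Γ₀) :
    T.run s (l₁ ++ l₂) =
      ((T.run (T.run s l₁).1 l₂).1, (T.run s l₁).2 ++ (T.run (T.run s l₁).1 l₂).2) := by
  induction l₁ generalizing s with
  | nil => simp
  | cons a l ih => simp [ih, List.append_assoc]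

/-- The transduction computed by `T`: `front s ++ body` (or just `front s` if `keep s` fails),
where `(s, body) = T.run T.init l`. [folklore] -/
def eval (l : List Γ₀) : List Γ₁ :=
  T.front (T.run T.init l).1 ++ if T.keep (T.run T.init l).1 then (T.run T.init l).2 else []

/-- Uniform bound on the length of emitted words. [folklore] -/
noncomputable def maxEmit [Fintype σ] [Fintype Γ₀] : ℕ :=
  Finset.univ.sup fun p : σ × Γ₀ => (T.step p.1 p.2).2.length

/-- Uniform bound on the length of `front`. [folklore] -/
noncomputable def maxFront [Fintype σ] : ℕ :=
  Finset.univ.sup fun s : σ => (T.front s).length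

/-- The emitted body has length at most `maxEmit · |l|`. [folklore] -/
theorem length_run_le [Fintype σ] [Fintype Γ₀] (s : σ) (l : List Γ₀) :
    (T.run s l).2.length ≤ T.maxEmit * l.length := by
  induction l generalizing s with
  | nil => simp
  | cons a l ih =>
    simp only [run_cons, List.length_append, List.length_cons, Nat.mul_succ]
    have h1 := ih (T.step s a).1
    have h2 : (T.step s a).2.length ≤ T.maxEmit :=
      Finset.le_sup (f := fun p : σ × Γ₀ => (T.step p.1 p.2).2.length) (Finset.mem_univ (s, a))
    omega

/-- The transduction has length at most `maxEmit · |l| + maxFront`. [folklore] -/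
theorem length_eval_le [Fintype σ] [Fintype Γ₀] (l : List Γ₀) :
    (T.eval l).length ≤ T.maxEmit * l.length + T.maxFront := by
  have h1 := T.length_run_le T.init l
  have h2 : (T.front (T.run T.init l).1).length ≤ T.maxFront :=
    Finset.le_sup (f := fun s : σ => (T.front s).length) (Finset.mem_univ _)
  unfold eval
  split <;> simp <;> omega

/-- A polynomial (indeed linear) bound on the output length. [folklore] -/
theorem exists_poly_length_eval_le [Fintype σ] [Fintype Γ₀] :
    ∃ q : Polynomial ℕ, ∀ l, (T.eval l).length ≤ q.eval l.length :=
  ⟨Polynomial.C T.maxEmit * Polynomial.X + Polynomial.C T.maxFront, fun l => by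
    simpa using T.length_eval_le l⟩

end FST

namespace TM2Lift

/-! ### private helpers: chaining exact runs, multi-push -/

section Helpers

variable {C : Type} (f : C → Option C)

/-- Peeling off the first step of an iteration (`TM2Comp.iterate_bind_succ` plus the step
equation). [folklore] -/
private theorem iterate_bind_succ_of_step {a b : C} (h : f a = some b) (n : ℕ) :
    (flip bind f)^[n + 1] (some a) = (flip bind f)^[n] (some b) := by
  rw [TM2Comp.iterate_bind_succ, h]

/-- Concatenating two exact runs (`m` steps then `n` steps). [folklore] -/
private theorem iterate_bind_trans {a b : C} {c : Option C} {m n : ℕ}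
    (h₁ : (flip bind f)^[m] (some a) = some b) (h₂ : (flip bind f)^[n] (some b) = c) :
    (flip bind f)^[n + m] (some a) = c := by
  rw [Function.iterate_add_apply, h₁, h₂]

variable {K : Type} [DecidableEq K] {Γ : K → Type} {Λ σ' : Type}

/-- Push the fixed word `w` onto stack `k` (afterwards the stack reads `w ++ old`), then
continue with `q`; all within one TM2 step. [folklore] -/
private def pushAll (k : K) : List (Γ k) → TM2.Stmt Γ Λ σ' → TM2.Stmt Γ Λ σ'
  | [], q => q
  | a :: w, q => Literature.Computability.Complexity.TM2Lift.pushAll k w (.push k (fun _ => a) q)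

/-- Semantics of `pushAll`. [folklore] -/
private theorem stepAux_pushAll (k : K) (w : List (Γ k)) (q : TM2.Stmt Γ Λ σ') (v : σ')
    (S : ∀ k, List (Γ k)) :
    TM2.stepAux (Literature.Computability.Complexity.TM2Lift.pushAll k w q) v S = TM2.stepAux q v (Function.update S k (w ++ S k)) := by
  induction w generalizing S q with
  | nil => simp [Literature.Computability.Complexity.TM2Lift.pushAll]
  | cons a w ih =>
    simp only [Literature.Computability.Complexity.TM2Lift.pushAll, ih, TM2.stepAux, Function.update_self, Function.update_idem,
      List.cons_append]

end Helpers

/-! ### the transducer machine -/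

/-- The three stacks of the transducer machine. [folklore] -/
inductive Stk3 | inp | aux | out
  deriving DecidableEq

/-- finiteness, by enumeration [folklore] -/
instance : Fintype Stk3 := ⟨{.inp, .aux, .out}, by intro x; cases x <;> simp⟩

/-- The three labels of the transducer machine. [folklore] -/
inductive FSTLabel | read | move | finish
  deriving DecidableEq

/-- finiteness, by enumeration [folklore] -/
instance : Fintype FSTLabel := ⟨{.read, .move, .finish}, by intro x; cases x <;> simp⟩

section FSTMachine

variable {σ Γ₀ Γ₁ : Type} [Fintype σ] [Fintype Γ₀] [Fintype Γ₁] (T : FST σ Γ₀ Γ₁)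

/-- stack alphabets [folklore] -/
@[reducible] def fstΓ (Γ₀ Γ₁ : Type) : Stk3 → Type
  | .inp => Γ₀
  | .aux => Γ₁
  | .out => Γ₁

/-- states: transducer state, last input symbol, last transferred symbol [folklore] -/
abbrev FSTSt (σ Γ₀ Γ₁ : Type) : Type := (σ × Option Γ₀) × Option Γ₁

/-- statements of the transducer machine [folklore] -/
abbrev FSTStmt (σ Γ₀ Γ₁ : Type) : Type := TM2.Stmt (fstΓ Γ₀ Γ₁) FSTLabel (FSTSt σ Γ₀ Γ₁)

/-- the halting tail: reset the state and halt [folklore] -/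
def fstFin : FSTStmt σ Γ₀ Γ₁ := .load (fun _ => ((T.init, none), none)) .halt

/-- read phase: emit by case distinction on (state, symbol) [folklore] -/
noncomputable def fstEmit : FSTStmt σ Γ₀ Γ₁ :=
  (Finset.univ : Finset (σ × Γ₀)).toList.foldr
    (fun p r => .branch (fun v => @decide (v.1 = (p.1, some p.2)) (Classical.dec _))
      (Literature.Computability.Complexity.TM2Lift.pushAll Stk3.aux ((T.step p.1 p.2).2.reverse)
        (.load (fun v => (((T.step p.1 p.2).1, none), v.2)) (.goto fun _ => FSTLabel.read))) r)
    (.goto fun _ => FSTLabel.read)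

/-- move phase: push the transferred symbol onto the output stack [folklore] -/
noncomputable def fstOut : FSTStmt σ Γ₀ Γ₁ :=
  (Finset.univ : Finset Γ₁).toList.foldr
    (fun b r => .branch (fun v => @decide (v.2 = some b) (Classical.dec _))
      (.push Stk3.out (fun _ => b) (.goto fun _ => FSTLabel.move)) r)
    (.goto fun _ => FSTLabel.move)

/-- finish: push `front` by case distinction on the state [folklore] -/
noncomputable def fstFront : FSTStmt σ Γ₀ Γ₁ :=
  (Finset.univ : Finset σ).toList.foldr
    (fun s r => .branch (fun v => @decide (v.1.1 = s) (Classical.dec _))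
      (Literature.Computability.Complexity.TM2Lift.pushAll Stk3.out (T.front s) (fstFin T)) r)
    (fstFin T)

/-- The program. [folklore] -/
noncomputable def fstStmt : FSTLabel → FSTStmt σ Γ₀ Γ₁
  | .read => .pop Stk3.inp (fun v o => ((v.1.1, o), v.2))
      (.branch (fun v => v.1.2.isSome) (fstEmit T) (.goto fun _ => FSTLabel.move))
  | .move => .pop Stk3.aux (fun v o => (v.1, o))
      (.branch (fun v => v.2.isSome)
        (.branch (fun v => T.keep v.1.1) (fstOut (σ := σ) (Γ₀ := Γ₀)) (.goto fun _ => FSTLabel.move))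
        (.goto fun _ => FSTLabel.finish))
  | .finish => fstFront T

/-- The transducer machine. [folklore] -/
@[reducible] noncomputable def fstTM : FinTM2 where
  K := Stk3
  k₀ := .inp
  k₁ := .out
  Γ := fstΓ Γ₀ Γ₁
  Λ := FSTLabel
  main := .read
  σ := FSTSt σ Γ₀ Γ₁
  initialState := ((T.init, none), none)
  m := fstStmt T

/-- stack contents from the three components [folklore] -/
def fstStk (i : List Γ₀) (a o : List Γ₁) : ∀ k, List (fstΓ Γ₀ Γ₁ k)
  | .inp => i
  | .aux => a
  | .out => o

omit [Fintype σ] [Fintype Γ₀] [Fintype Γ₁] in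
/-- Updating the input stack of `fstStk`. [folklore] -/
@[simp] theorem fstStk_update_inp (i i' : List Γ₀) (a o : List Γ₁) :
    Function.update (fstStk i a o) Stk3.inp i' = fstStk i' a o := by
  funext k; cases k
  · simp; rfl
  · rw [Function.update_of_ne (by decide)]; rfl
  · rw [Function.update_of_ne (by decide)]; rfl

omit [Fintype σ] [Fintype Γ₀] [Fintype Γ₁] in
/-- Updating the auxiliary stack of `fstStk`. [folklore] -/
@[simp] theorem fstStk_update_aux (i : List Γ₀) (a a' o : List Γ₁) :
    Function.update (fstStk i a o) Stk3.aux a' = fstStk i a' o := by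
  funext k; cases k
  · rw [Function.update_of_ne (by decide)]; rfl
  · simp; rfl
  · rw [Function.update_of_ne (by decide)]; rfl

omit [Fintype σ] [Fintype Γ₀] [Fintype Γ₁] in
/-- Updating the output stack of `fstStk`. [folklore] -/
@[simp] theorem fstStk_update_out (i : List Γ₀) (a o o' : List Γ₁) :
    Function.update (fstStk i a o) Stk3.out o' = fstStk i a o' := by
  funext k; cases k
  · rw [Function.update_of_ne (by decide)]; rfl
  · rw [Function.update_of_ne (by decide)]; rfl
  · simp; rfl

omit [Fintype σ] [Fintype Γ₀] [Fintype Γ₁] in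
/-- Reading the input stack of `fstStk`. [folklore] -/
@[simp] theorem fstStk_inp (i : List Γ₀) (a o : List Γ₁) : fstStk i a o Stk3.inp = i := rfl
omit [Fintype σ] [Fintype Γ₀] [Fintype Γ₁] in
/-- Reading the auxiliary stack of `fstStk`. [folklore] -/
@[simp] theorem fstStk_aux (i : List Γ₀) (a o : List Γ₁) : fstStk i a o Stk3.aux = a := rfl
omit [Fintype σ] [Fintype Γ₀] [Fintype Γ₁] in
/-- Reading the output stack of `fstStk`. [folklore] -/
@[simp] theorem fstStk_out (i : List Γ₀) (a o : List Γ₁) : fstStk i a o Stk3.out = o := rfl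

omit [Fintype Γ₁] in
/-- semantics of `fstEmit` [folklore] -/
theorem stepAux_fstEmit (s : σ) (x : Γ₀) (o₂ : Option Γ₁) (S : ∀ k, List (fstΓ Γ₀ Γ₁ k)) :
    TM2.stepAux (fstEmit T) ((s, some x), o₂) S =
      ⟨some FSTLabel.read, (((T.step s x).1, none), o₂),
        Function.update S Stk3.aux ((T.step s x).2.reverse ++ S Stk3.aux)⟩ := by
  unfold fstEmit
  have ha : (s, x) ∈ (Finset.univ : Finset (σ × Γ₀)).toList :=
    Finset.mem_toList.2 (Finset.mem_univ _)
  generalize (Finset.univ : Finset (σ × Γ₀)).toList = L at ha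
  induction L with
  | nil => simp at ha
  | cons p L ih =>
    simp only [List.foldr_cons, TM2.stepAux]
    by_cases h : (s, x) = p
    · subst h
      rw [@decide_eq_true _ (Classical.dec _) rfl]
      simp [Literature.Computability.Complexity.TM2Lift.stepAux_pushAll]
    · have : (s, x) ∈ L := by simpa [h] using ha
      rw [@decide_eq_false _ (Classical.dec _) (by
        rintro h'; apply h; obtain ⟨p1, p2⟩ := p
        simp only [Prod.mk.injEq, Option.some.injEq] at h'; rw [h'.1, h'.2])]
      exact ih this

omit [Fintype σ] [Fintype Γ₀] in
/-- semantics of `fstOut` [folklore] -/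
theorem stepAux_fstOut (s : σ × Option Γ₀) (b : Γ₁) (S : ∀ k, List (fstΓ Γ₀ Γ₁ k)) :
    TM2.stepAux (fstOut (σ := σ) (Γ₀ := Γ₀)) (s, some b) S =
      ⟨some FSTLabel.move, (s, some b), Function.update S Stk3.out (b :: S Stk3.out)⟩ := by
  unfold fstOut
  have ha : b ∈ (Finset.univ : Finset Γ₁).toList := Finset.mem_toList.2 (Finset.mem_univ _)
  generalize (Finset.univ : Finset Γ₁).toList = L at ha
  induction L with
  | nil => simp at ha
  | cons b' L ih =>
    simp only [List.foldr_cons, TM2.stepAux]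
    by_cases h : b = b'
    · subst h
      rw [@decide_eq_true _ (Classical.dec _) rfl]
      simp
    · have : b ∈ L := by simpa [h] using ha
      rw [@decide_eq_false _ (Classical.dec _) (by simpa using h)]
      exact ih this

omit [Fintype Γ₀] [Fintype Γ₁] in
/-- semantics of `fstFront` [folklore] -/
theorem stepAux_fstFront (s : σ) (o₁ : Option Γ₀) (o₂ : Option Γ₁)
    (S : ∀ k, List (fstΓ Γ₀ Γ₁ k)) :
    TM2.stepAux (fstFront T) ((s, o₁), o₂) S =
      ⟨none, ((T.init, none), none), Function.update S Stk3.out (T.front s ++ S Stk3.out)⟩ := by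
  unfold fstFront
  have ha : s ∈ (Finset.univ : Finset σ).toList := Finset.mem_toList.2 (Finset.mem_univ _)
  generalize (Finset.univ : Finset σ).toList = L at ha
  induction L with
  | nil => simp at ha
  | cons s' L ih =>
    simp only [List.foldr_cons, TM2.stepAux]
    by_cases h : s = s'
    · subst h
      rw [@decide_eq_true _ (Classical.dec _) rfl]
      simp [Literature.Computability.Complexity.TM2Lift.stepAux_pushAll, fstFin]
    · have : s ∈ L := by simpa [h] using ha
      rw [@decide_eq_false _ (Classical.dec _) (by simpa using h)]
      exact ih this

/-- read phase [folklore] -/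
theorem fst_read (o₂ : Option Γ₁) (w : List Γ₁) (l : List Γ₀) :
    ∀ (s : σ) (acc : List Γ₁),
      (flip bind (TM2.step (fstStmt T)))^[l.length + 1]
          (some ⟨some FSTLabel.read, ((s, none), o₂), fstStk l acc w⟩) =
        some ⟨some FSTLabel.move, (((T.run s l).1, none), o₂),
          fstStk [] ((T.run s l).2.reverse ++ acc) w⟩ := by
  induction l with
  | nil =>
    intro s acc
    rw [iterate_bind_succ_of_step _ (b := ⟨some FSTLabel.move, ((s, none), o₂), fstStk [] acc w⟩)]
    · simp
    · simp [TM2.step, fstStmt, TM2.stepAux]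
  | cons x l ih =>
    intro s acc
    rw [List.length_cons, iterate_bind_succ_of_step _
      (b := ⟨some FSTLabel.read, (((T.step s x).1, none), o₂),
        fstStk l ((T.step s x).2.reverse ++ acc) w⟩)]
    · rw [ih]
      simp [List.reverse_append, List.append_assoc]
    · simp [TM2.step, fstStmt, TM2.stepAux, stepAux_fstEmit]

/-- move phase [folklore] -/
theorem fst_move (s : σ) (xs : List Γ₁) :
    ∀ (o₂ : Option Γ₁) (w : List Γ₁),
      (flip bind (TM2.step (fstStmt T)))^[xs.length + 1]
          (some ⟨some FSTLabel.move, ((s, none), o₂), fstStk [] xs w⟩) =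
        some ⟨some FSTLabel.finish, ((s, none), none),
          fstStk [] [] ((if T.keep s then xs.reverse else []) ++ w)⟩ := by
  induction xs with
  | nil =>
    intro o₂ w
    rw [iterate_bind_succ_of_step _ (b := ⟨some FSTLabel.finish, ((s, none), none),
      fstStk [] [] w⟩)]
    · simp
    · simp [TM2.step, fstStmt, TM2.stepAux]
  | cons b xs ih =>
    intro o₂ w
    rw [List.length_cons, iterate_bind_succ_of_step _
      (b := ⟨some FSTLabel.move, ((s, none), some b),
        fstStk [] xs (if T.keep s then b :: w else w)⟩)]
    · rw [ih]
      cases T.keep s <;> simp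
    · cases hk : T.keep s <;> simp [TM2.step, fstStmt, TM2.stepAux, stepAux_fstOut, hk]

/-- The initial configuration of `fstTM` in `fstStk` form. [folklore] -/
theorem fst_initList (l : List Γ₀) :
    initList (fstTM T) l = ⟨some FSTLabel.read, ((T.init, none), none), fstStk l [] []⟩ := by
  rw [TM2Comp.initList_eq]; congr; funext k; cases k <;> rfl

/-- The halting configuration of `fstTM` in `fstStk` form. [folklore] -/
theorem fst_haltList (w : List Γ₁) :
    haltList (fstTM T) w = ⟨none, ((T.init, none), none), fstStk [] [] w⟩ := by
  rw [TM2Comp.haltList_eq]; congr; funext k; cases k <;> rfl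

/-- full run of the transducer machine [folklore] -/
theorem fst_run (l : List Γ₀) :
    (flip bind (fstTM T).step)^[l.length + (T.run T.init l).2.length + 3]
        (some (initList (fstTM T) l)) = some (haltList (fstTM T) (T.eval l)) := by
  have h1 := fst_read T none [] l T.init []
  have h2 := fst_move T (T.run T.init l).1 ((T.run T.init l).2.reverse ++ []) none []
  have h3 : (flip bind (TM2.step (fstStmt T)))^[1]
      (some ⟨some FSTLabel.finish, (((T.run T.init l).1, none), none),
        fstStk [] [] ((if T.keep (T.run T.init l).1 then
          ((T.run T.init l).2.reverse ++ []).reverse else []) ++ [])⟩) =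
      some (haltList (fstTM T) (T.eval l)) := by
    rw [fst_haltList, Function.iterate_one]
    simp only [flip, Option.bind_eq_bind, Option.bind_some, TM2.step, fstStmt,
      stepAux_fstFront, fstStk_update_out, fstStk_out]
    congr 2
    simp [FST.eval]
  have := iterate_bind_trans _ h1 (iterate_bind_trans _ h2 h3)
  rw [fst_initList]
  rw [show l.length + (T.run T.init l).2.length + 3 =
    1 + (((T.run T.init l).2.reverse ++ []).length + 1) + (l.length + 1) by simp; omega]
  exact this

/-- **Finite-state transductions are linear-time computable** (on Mathlib's TM2 model):
`T.eval` is computed within `(maxEmit + 1) · n + (3)` steps. [folklore] -/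
theorem _root_.Literature.Computability.Complexity.FST.timeComputable_eval :
    TimeComputable (id : List Γ₀ → List Γ₀) (id : List Γ₁ → List Γ₁) T.eval
      (fun n => (T.maxEmit + 1) * n + 3) := by
  let M : TM2ComputableAux Γ₀ Γ₁ := ⟨fstTM T, Equiv.refl _, Equiv.refl _⟩
  refine ⟨M, fun l => ⟨⟨⟨l.length + (T.run T.init l).2.length + 3, ?_⟩, ?_⟩⟩⟩
  · simpa [M] using fst_run T l
  · have := T.length_run_le T.init l
    simp only [id, Nat.succ_mul]
    generalize T.maxEmit * l.length = P at this
    omega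

/-- Finite-state transductions are polynomial-time computable. [folklore] -/
theorem _root_.Literature.Computability.Complexity.FST.polyTimeComputable_eval :
    PolyTimeComputable (id : List Γ₀ → List Γ₀) (id : List Γ₁ → List Γ₁) T.eval :=
  ⟨Polynomial.C (T.maxEmit + 1) * Polynomial.X + 3, by
    simpa using T.timeComputable_eval⟩

end FSTMachine

end TM2Lift

end Literature.Computability.Complexity
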